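import Literature.NumberTheory.Sieve.SmoothParityAsymptoticLemmas
import HarnessLib

/-!
# Decay of the flat major-arc error along the polylog regime: the five terms

Topic `Literature/NumberTheory/Sieve`, namespace `Literature.NumberTheory.Sieve.SmoothArcs`; a PROVED bookkeeping file
([Harper2016, §5]).  The flat errors `F` (`SmoothParityMajorArcsFlat`) and `s` (`SmoothParityMinorArcsFlat`) of the
zeroth-order circle method are bounded, for the parameter choice of `SmoothParityAsymptotic`
(`L = log x`, `R ∈ [L^r/2, L^r]`, `r = 10B + 300`, `Λ = R⁴`, `e_B = L^B`, `η = C_W(B'+1)² log y/L`, `y ≤ L^{100000}`,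
`G₀ = x^{1−10⁻⁴}/(√(6π)L)`, `Φ = 3L²`, `R_b = R/e_B`), by constant multiples of the single decaying gauge
`g(x) = (log L)²/L + L^{−1/6} + L^{N} x^{−1/20}` (`N = 23r + 3B + 200051`).  This file: the atomic inequalities
and the five terms of `F` (`major_term_eta`, `_off`, `_delta`, `_W`, `_tail`); the packaging (`major_rate`, `minor_rate`) is in
`SmoothParityAsymptoticRates`.  Pure real arithmetic.

## References

* A. J. Harper, Compositio Math. 152 (2016), §5 [Harper2016].
-/

noncomputable section

open Real

namespace Literature.NumberTheory.Sieve

namespace SmoothArcs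

/-! ### Atomic inequalities in the range `L ≥ 3`, `x ≥ 1` -/

section Atoms

variable {L x R : ℝ} {B : ℕ}

/-- `1/L ≤ L^{−1/6}` for `L ≥ 1`. [folklore] -/
theorem inv_le_rpow_neg_sixth (hL : 1 ≤ L) : 1 / L ≤ L ^ (-(1 / 6 : ℝ)) := by
  rw [one_div, ← Real.rpow_neg_one]
  exact Real.rpow_le_rpow_of_exponent_le hL (by norm_num)

/-- `1/L^n ≤ L^{−1/6}` for `L ≥ 1`, `n ≥ 1`. [folklore] -/
theorem inv_pow_le_rpow_neg_sixth (hL : 1 ≤ L) {n : ℕ} (hn : 1 ≤ n) : 1 / L ^ n ≤ L ^ (-(1 / 6 : ℝ)) := by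
  refine le_trans ?_ (inv_le_rpow_neg_sixth hL)
  exact div_le_div_of_nonneg_left zero_le_one (by linarith) (by simpa using pow_le_pow_right₀ hL hn)

/-- `x^{−a} ≤ x^{−1/20}` for `x ≥ 1`, `a ≥ 1/20`. [folklore] -/
theorem rpow_neg_le_gauge (hx : 1 ≤ x) {a : ℝ} (ha : 1 / 20 ≤ a) : x ^ (-a) ≤ x ^ (-(1 / 20 : ℝ)) :=
  Real.rpow_le_rpow_of_exponent_le hx (by linarith)

/-- `1/R ≤ 2 L^{−1/6}` for `L^r/2 ≤ R`, `L ≥ 1`, `r ≥ 1`. [folklore] -/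
theorem inv_R_le (hL : 1 ≤ L) {r : ℕ} (hr : 1 ≤ r) (hR : L ^ r / 2 ≤ R) : 1 / R ≤ 2 * L ^ (-(1 / 6 : ℝ)) := by
  have hLr : 1 ≤ L ^ r := one_le_pow₀ hL
  have hR0 : 0 < R := by linarith
  calc 1 / R ≤ 1 / (L ^ r / 2) := div_le_div_of_nonneg_left zero_le_one (by linarith) hR
    _ = 2 * (1 / L ^ r) := by field_simp
    _ ≤ 2 * L ^ (-(1 / 6 : ℝ)) := mul_le_mul_of_nonneg_left (inv_pow_le_rpow_neg_sixth hL hr) zero_le_two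

/-- `R^k ≤ L^{rk}` for `0 ≤ R ≤ L^r`. [folklore] -/
theorem R_pow_le (hR0 : 0 ≤ R) {r : ℕ} (hR : R ≤ L ^ r) (k : ℕ) : R ^ k ≤ L ^ (r * k) := by
  rw [pow_mul]; exact pow_le_pow_left₀ hR0 hR k

/-- `log 2x ≤ 2L` and `log 2e_B ≤ 1 + B log L` (`L = log x ≥ 1`, `e_B = L^B`). [folklore] -/
theorem log_two_mul_le {x : ℝ} (hx : 0 < x) (hL : 1 ≤ Real.log x) : Real.log (2 * x) ≤ 2 * Real.log x := by
  rw [Real.log_mul two_ne_zero hx.ne']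
  have := Real.log_two_lt_d9
  linarith

/-- `log(2L^B) ≤ 1 + B log L` for `L ≥ 1`. [folklore] -/
theorem log_two_mul_pow_le (hL : 1 ≤ L) (B : ℕ) : Real.log (2 * L ^ B) ≤ 1 + B * Real.log L := by
  rw [Real.log_mul two_ne_zero (by positivity), Real.log_pow]
  have := Real.log_two_lt_d9
  linarith

end Atoms

/-! ### The five terms of the flat major-arc error -/

section Major

variable {x R P H D C_F C_W : ℝ} {y : ℕ} {B : ℕ}

/-- The `η`-term: `P³H·331η(28 + 16 log 2e_B) ≤ A₁ (log L)²/L` with `η = C_W(B'+1)² log y/L`, `log y ≤ 10⁵ log L`.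
[folklore] -/
theorem major_term_eta (hL3 : 3 ≤ Real.log x) (hy1 : 1 ≤ y) (hyK : (y : ℝ) ≤ Real.log x ^ 100000)
    (hP : 1 ≤ P) (hH : 1 ≤ H) (hCW : 0 ≤ C_W) (B' : ℕ) :
    P ^ 3 * H * (331 * (C_W * ((B' : ℝ) + 1) ^ 2 * Real.log (y : ℝ) / Real.log x) *
        (28 + 16 * Real.log (2 * Real.log x ^ B))) ≤
      (331 * P ^ 3 * H * C_W * ((B' : ℝ) + 1) ^ 2 * 100000 * (44 + 16 * B)) *
        (Real.log (Real.log x) ^ 2 / Real.log x) ∧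
    C_W * ((B' : ℝ) + 1) ^ 2 * Real.log (y : ℝ) / Real.log x ≤
      (C_W * ((B' : ℝ) + 1) ^ 2 * 100000) * (Real.log (Real.log x) ^ 2 / Real.log x) := by
  set L := Real.log x with hL
  have hL1 : 1 ≤ L := by linarith
  have hL0 : 0 < L := by linarith
  have hlL : 1 ≤ Real.log L := by
    rw [Real.le_log_iff_exp_le (by linarith)]
    have := Real.exp_one_lt_d9
    linarith
  have hy0 : (0 : ℝ) < y := by exact_mod_cast (show 0 < y by omega)
  have hly0 : 0 ≤ Real.log (y : ℝ) := Real.log_nonneg (by exact_mod_cast hy1)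
  have hly : Real.log (y : ℝ) ≤ 100000 * Real.log L := by
    have h := Real.log_le_log hy0 hyK
    rwa [Real.log_pow] at h
  have hly' : Real.log (y : ℝ) ≤ 100000 * Real.log L ^ 2 := hly.trans (by nlinarith)
  have hlog2eB : Real.log (2 * L ^ B) ≤ 1 + B * Real.log L := log_two_mul_pow_le hL1 B
  have h28 : 28 + 16 * Real.log (2 * L ^ B) ≤ (44 + 16 * B) * Real.log L := by nlinarith
  have h28' : 0 ≤ 28 + 16 * Real.log (2 * L ^ B) := by
    have : 0 ≤ Real.log (2 * L ^ B) := Real.log_nonneg (by nlinarith [one_le_pow₀ (n := B) hL1])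
    linarith
  constructor
  · calc P ^ 3 * H * (331 * (C_W * ((B' : ℝ) + 1) ^ 2 * Real.log (y : ℝ) / L) * (28 + 16 * Real.log (2 * L ^ B)))
        = (331 * P ^ 3 * H * C_W * ((B' : ℝ) + 1) ^ 2) * (Real.log (y : ℝ) * (28 + 16 * Real.log (2 * L ^ B))) / L := by
          ring
      _ ≤ (331 * P ^ 3 * H * C_W * ((B' : ℝ) + 1) ^ 2) * ((100000 * Real.log L) * ((44 + 16 * B) * Real.log L)) / L := by
          refine div_le_div_of_nonneg_right (mul_le_mul_of_nonneg_left ?_ (by positivity)) hL0.le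
          exact mul_le_mul hly h28 h28' (by positivity)
      _ = _ := by ring
  · calc C_W * ((B' : ℝ) + 1) ^ 2 * Real.log (y : ℝ) / L = C_W * ((B' : ℝ) + 1) ^ 2 * (Real.log (y : ℝ) / L) := by ring
      _ ≤ C_W * ((B' : ℝ) + 1) ^ 2 * (100000 * Real.log L ^ 2 / L) :=
          mul_le_mul_of_nonneg_left (div_le_div_of_nonneg_right hly' hL0.le) (by positivity)
      _ = _ := by ring

/-- The off-arc term: `100P³H(e_B/(3R) + 8D(1 + 2e_B(1 + log 2x))/x) ≤ 5600P³HD(L^{−1/6} + L^N x^{−1/20})`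
(`e_B = L^B`, `R ≥ L^r/2`, `r ≥ B + 1`, `N ≥ B + 1`). [folklore] -/
theorem major_term_off (hL3 : 3 ≤ Real.log x) (hx1 : 1 ≤ x) {r N : ℕ} (hrB : B + 1 ≤ r) (hN : B + 1 ≤ N)
    (hR : Real.log x ^ r / 2 ≤ R) (hP : 1 ≤ P) (hH : 1 ≤ H) (hD : 1 ≤ D) :
    P ^ 3 * H * (100 * (Real.log x ^ B / (3 * R) + 8 * D * (1 + 2 * Real.log x ^ B * (1 + Real.log (2 * x))) / x)) ≤
      (5600 * P ^ 3 * H * D) * (Real.log x ^ (-(1 / 6 : ℝ)) + Real.log x ^ N * x ^ (-(1 / 20 : ℝ))) := by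
  set L := Real.log x with hL
  have hL1 : 1 ≤ L := by linarith
  have hx0 : 0 < x := by linarith
  have hLr : 1 ≤ L ^ r := one_le_pow₀ hL1
  have hR0 : 0 < R := by linarith
  -- `e_B/(3R) ≤ (2/3)/L^{r-B} ≤ L^{-1/6}`
  have h1 : L ^ B / (3 * R) ≤ L ^ (-(1 / 6 : ℝ)) := by
    have hsplit : L ^ r = L ^ B * L ^ (r - B) := by rw [← pow_add]; congr 1; omega
    calc L ^ B / (3 * R) ≤ L ^ B / (3 * (L ^ r / 2)) := div_le_div_of_nonneg_left (by positivity) (by positivity) (by linarith)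
      _ = 2 / 3 * (1 / L ^ (r - B)) := by rw [hsplit]; field_simp
      _ ≤ 1 * L ^ (-(1 / 6 : ℝ)) :=
          mul_le_mul (by norm_num) (inv_pow_le_rpow_neg_sixth hL1 (by omega)) (by positivity) zero_le_one
      _ = _ := one_mul _
  -- `8D(1 + 2L^B(1 + log 2x))/x ≤ 56 D L^N x^{-1/20}`
  have h2 : 8 * D * (1 + 2 * L ^ B * (1 + Real.log (2 * x))) / x ≤ 56 * D * (L ^ N * x ^ (-(1 / 20 : ℝ))) := by
    have hl2x : Real.log (2 * x) ≤ 2 * L := log_two_mul_le hx0 hL1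
    have hLB : L ^ B ≤ L ^ N := pow_le_pow_right₀ hL1 (by omega)
    have hLB1 : L ^ (B + 1) ≤ L ^ N := pow_le_pow_right₀ hL1 hN
    have hLN1 : 1 ≤ L ^ N := one_le_pow₀ hL1
    have hin : 1 + 2 * L ^ B * (1 + Real.log (2 * x)) ≤ 7 * L ^ N := by
      have : 2 * L ^ B * (1 + Real.log (2 * x)) ≤ 2 * L ^ B * (3 * L) :=
        mul_le_mul_of_nonneg_left (by linarith) (by positivity)
      have h' : 2 * L ^ B * (3 * L) = 6 * L ^ (B + 1) := by ring
      linarith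
    have hxinv : 1 / x ≤ x ^ (-(1 / 20 : ℝ)) := by
      rw [one_div, ← Real.rpow_neg_one]; exact rpow_neg_le_gauge hx1 (by norm_num)
    calc 8 * D * (1 + 2 * L ^ B * (1 + Real.log (2 * x))) / x = 8 * D * (1 + 2 * L ^ B * (1 + Real.log (2 * x))) * (1 / x) := by
          ring
      _ ≤ 8 * D * (7 * L ^ N) * x ^ (-(1 / 20 : ℝ)) :=
          mul_le_mul (mul_le_mul_of_nonneg_left hin (by positivity)) hxinv (by positivity) (by positivity)
      _ = _ := by ring
  have hg1 : 0 ≤ L ^ (-(1 / 6 : ℝ)) := Real.rpow_nonneg (by linarith) _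
  have hg2 : 0 ≤ L ^ N * x ^ (-(1 / 20 : ℝ)) := by positivity
  calc _ ≤ P ^ 3 * H * (100 * (L ^ (-(1 / 6 : ℝ)) + 56 * D * (L ^ N * x ^ (-(1 / 20 : ℝ))))) :=
        mul_le_mul_of_nonneg_left (mul_le_mul_of_nonneg_left (add_le_add h1 h2) (by norm_num)) (by positivity)
    _ ≤ P ^ 3 * H * (100 * (56 * D * L ^ (-(1 / 6 : ℝ)) + 56 * D * (L ^ N * x ^ (-(1 / 20 : ℝ))))) := by
        gcongr; nlinarith
    _ = _ := by ring

/-- The `Δ`-term: `R·Δ ≤ 32P(L^{−1/6} + L^N x^{−1/20})` with `Δ = 12(1+R⁴)Pe_B/x + 16P/(R⁴)³`, `R ∈ [L^r/2, L^r]`,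
`N ≥ 5r + B`. [folklore] -/
theorem major_term_delta (hL3 : 3 ≤ Real.log x) (hx1 : 1 ≤ x) {r N : ℕ} (hr : 1 ≤ r) (hN : 5 * r + B ≤ N)
    (hRlo : Real.log x ^ r / 2 ≤ R) (hRhi : R ≤ Real.log x ^ r) (hR1 : 1 ≤ R) (hP : 1 ≤ P) :
    R * (12 * (1 + R ^ 4) * P * Real.log x ^ B / x + 16 * P / (R ^ 4) ^ 3) ≤
      (32 * P) * (Real.log x ^ (-(1 / 6 : ℝ)) + Real.log x ^ N * x ^ (-(1 / 20 : ℝ))) := by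
  set L := Real.log x with hL
  have hL1 : 1 ≤ L := by linarith
  have hx0 : 0 < x := by linarith
  have hR0 : 0 < R := by linarith
  have h1 : R * (12 * (1 + R ^ 4) * P * L ^ B / x) ≤ 24 * P * (L ^ N * x ^ (-(1 / 20 : ℝ))) := by
    have hR5 : R * (1 + R ^ 4) ≤ 2 * L ^ (5 * r) := by
      have h4 : 1 ≤ R ^ 4 := one_le_pow₀ hR1
      calc R * (1 + R ^ 4) ≤ R * (2 * R ^ 4) := mul_le_mul_of_nonneg_left (by linarith) hR0.le
        _ = 2 * R ^ 5 := by ring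
        _ ≤ 2 * L ^ (r * 5) := by have := R_pow_le hR0.le hRhi 5; linarith
        _ = 2 * L ^ (5 * r) := by rw [mul_comm r 5]
    have hLN : L ^ (5 * r) * L ^ B ≤ L ^ N := by rw [← pow_add]; exact pow_le_pow_right₀ hL1 hN
    have hxinv : 1 / x ≤ x ^ (-(1 / 20 : ℝ)) := by
      rw [one_div, ← Real.rpow_neg_one]; exact rpow_neg_le_gauge hx1 (by norm_num)
    calc R * (12 * (1 + R ^ 4) * P * L ^ B / x) = 12 * P * ((R * (1 + R ^ 4)) * L ^ B) * (1 / x) := by ring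
      _ ≤ 12 * P * (2 * L ^ (5 * r) * L ^ B) * x ^ (-(1 / 20 : ℝ)) :=
          mul_le_mul (mul_le_mul_of_nonneg_left (mul_le_mul_of_nonneg_right hR5 (by positivity)) (by positivity))
            hxinv (by positivity) (by positivity)
      _ = 24 * P * (L ^ (5 * r) * L ^ B) * x ^ (-(1 / 20 : ℝ)) := by ring
      _ ≤ 24 * P * L ^ N * x ^ (-(1 / 20 : ℝ)) := by gcongr
      _ = _ := by ring
  have h2 : R * (16 * P / (R ^ 4) ^ 3) ≤ 32 * P * L ^ (-(1 / 6 : ℝ)) := by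
    have hRR : R / (R ^ 4) ^ 3 ≤ 1 / R := by
      rw [div_le_div_iff₀ (by positivity) hR0, one_mul]
      calc R * R = R ^ 2 := by ring
        _ ≤ R ^ 12 := pow_le_pow_right₀ hR1 (by norm_num)
        _ = (R ^ 4) ^ 3 := by ring
    calc R * (16 * P / (R ^ 4) ^ 3) = 16 * P * (R / (R ^ 4) ^ 3) := by ring
      _ ≤ 16 * P * (2 * L ^ (-(1 / 6 : ℝ))) :=
          mul_le_mul_of_nonneg_left (hRR.trans (inv_R_le hL1 hr hRlo)) (by positivity)
      _ = _ := by ring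
  have hg1 : 0 ≤ L ^ (-(1 / 6 : ℝ)) := Real.rpow_nonneg (by linarith) _
  have hg2 : 0 ≤ L ^ N * x ^ (-(1 / 20 : ℝ)) := by positivity
  rw [mul_add]
  calc _ ≤ 24 * P * (L ^ N * x ^ (-(1 / 20 : ℝ))) + 32 * P * L ^ (-(1 / 6 : ℝ)) := add_le_add h1 h2
    _ ≤ _ := by nlinarith

/-- `√(2π·3L²) = √(6π)·L` for `L ≥ 0`. [folklore] -/
theorem sqrt_two_pi_three_sq {L : ℝ} (hL : 0 ≤ L) : Real.sqrt (2 * Real.pi * (3 * L ^ 2)) = Real.sqrt (6 * Real.pi) * L := by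
  rw [show 2 * Real.pi * (3 * L ^ 2) = (6 * Real.pi) * L ^ 2 by ring, Real.sqrt_mul (by positivity), Real.sqrt_sq hL]

/-- The `W`-term: `R⁹·W ≤ 32√(6π)(C_F+1)P(L^{−1/6} + L^N x^{−1/20})` with
`W = 2RC_F x^{1/2+1/100}(2R)^{1/100}(1+R⁴)³Pe_B/G₀ + 16√(2πΦ)P/(R⁴)³`, `G₀ = x^{1−10⁻⁴}/(√(6π)L)`, `Φ = 3L²`,
`R ∈ [L^r/2, L^r]`, `r ≥ 2`, `N ≥ 23r + B + 1`. [folklore] -/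
theorem major_term_W (hL3 : 3 ≤ Real.log x) (hx1 : 1 ≤ x) {r N : ℕ} (hr : 2 ≤ r) (hN : 23 * r + B + 1 ≤ N)
    (hRlo : Real.log x ^ r / 2 ≤ R) (hRhi : R ≤ Real.log x ^ r) (hR1 : 1 ≤ R) (hP : 1 ≤ P) (hCF : 0 ≤ C_F) :
    R ^ 9 * (2 * R * C_F * x ^ (1 / 2 + 1 / 100 : ℝ) * (2 * R) ^ (1 / 100 : ℝ) * (1 + R ^ 4) ^ 3 * P * Real.log x ^ B /
          (x ^ (1 - 1 / 10000 : ℝ) / (Real.sqrt (6 * Real.pi) * Real.log x)) +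
        16 * Real.sqrt (2 * Real.pi * (3 * Real.log x ^ 2)) * P / (R ^ 4) ^ 3) ≤
      (32 * Real.sqrt (6 * Real.pi) * (C_F + 1) * P) * (Real.log x ^ (-(1 / 6 : ℝ)) + Real.log x ^ N * x ^ (-(1 / 20 : ℝ))) := by
  set L := Real.log x with hL
  have hL1 : 1 ≤ L := by linarith
  have hL0 : 0 ≤ L := by linarith
  have hx0 : 0 < x := by linarith
  have hR0 : 0 < R := by linarith
  set S6 : ℝ := Real.sqrt (6 * Real.pi) with hS6
  have hS60 : 0 < S6 := Real.sqrt_pos.2 (by positivity)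
  -- first part
  have h1 : R ^ 9 * (2 * R * C_F * x ^ (1 / 2 + 1 / 100 : ℝ) * (2 * R) ^ (1 / 100 : ℝ) * (1 + R ^ 4) ^ 3 * P * L ^ B /
      (x ^ (1 - 1 / 10000 : ℝ) / (S6 * L))) ≤ 32 * S6 * C_F * P * (L ^ N * x ^ (-(1 / 20 : ℝ))) := by
    have h2R : (2 * R) ^ (1 / 100 : ℝ) ≤ 2 * R := by
      calc (2 * R) ^ (1 / 100 : ℝ) ≤ (2 * R) ^ (1 : ℝ) := Real.rpow_le_rpow_of_exponent_le (by linarith) (by norm_num)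
        _ = 2 * R := Real.rpow_one _
    have h14 : (1 + R ^ 4) ^ 3 ≤ 8 * R ^ 12 := by
      have : 1 + R ^ 4 ≤ 2 * R ^ 4 := by linarith [one_le_pow₀ (n := 4) hR1]
      calc (1 + R ^ 4) ^ 3 ≤ (2 * R ^ 4) ^ 3 := pow_le_pow_left₀ (by positivity) this 3
        _ = 8 * R ^ 12 := by ring
    have hR23 : R ^ 23 ≤ L ^ (r * 23) := R_pow_le hR0.le hRhi 23
    have hLN : L ^ (r * 23) * L ^ B * L ≤ L ^ N := by
      rw [← pow_add, ← pow_succ]; exact pow_le_pow_right₀ hL1 (by omega)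
    have hxpow : x ^ (1 / 2 + 1 / 100 : ℝ) / x ^ (1 - 1 / 10000 : ℝ) ≤ x ^ (-(1 / 20 : ℝ)) := by
      rw [← Real.rpow_sub hx0]
      exact Real.rpow_le_rpow_of_exponent_le hx1 (by norm_num)
    calc _ = ((2 * (2 * R) ^ (1 / 100 : ℝ)) * (1 + R ^ 4) ^ 3 * R ^ 10) * (C_F * P * S6) * (L ^ B * L) *
          (x ^ (1 / 2 + 1 / 100 : ℝ) / x ^ (1 - 1 / 10000 : ℝ)) := by
          field_simp
      _ ≤ ((2 * (2 * R)) * (8 * R ^ 12) * R ^ 10) * (C_F * P * S6) * (L ^ B * L) * x ^ (-(1 / 20 : ℝ)) := by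
          gcongr
      _ = 32 * S6 * C_F * P * (R ^ 23 * L ^ B * L) * x ^ (-(1 / 20 : ℝ)) := by ring
      _ ≤ 32 * S6 * C_F * P * (L ^ (r * 23) * L ^ B * L) * x ^ (-(1 / 20 : ℝ)) := by gcongr
      _ ≤ 32 * S6 * C_F * P * L ^ N * x ^ (-(1 / 20 : ℝ)) := by gcongr
      _ = _ := by ring
  -- second part
  have h2 : R ^ 9 * (16 * Real.sqrt (2 * Real.pi * (3 * L ^ 2)) * P / (R ^ 4) ^ 3) ≤ 32 * S6 * P * L ^ (-(1 / 6 : ℝ)) := by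
    rw [sqrt_two_pi_three_sq hL0]
    have hRR : R ^ 9 / (R ^ 4) ^ 3 ≤ 1 / R := by
      rw [div_le_div_iff₀ (by positivity) hR0, one_mul]
      calc R ^ 9 * R = R ^ 10 := by ring
        _ ≤ R ^ 12 := pow_le_pow_right₀ hR1 (by norm_num)
        _ = (R ^ 4) ^ 3 := by ring
    have hLR : L * (1 / R) ≤ 2 * L ^ (-(1 / 6 : ℝ)) := by
      have hsplit : L ^ r = L ^ (r - 1) * L := by rw [← pow_succ]; congr 1; omega
      calc L * (1 / R) ≤ L * (1 / (L ^ r / 2)) :=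
            mul_le_mul_of_nonneg_left (div_le_div_of_nonneg_left zero_le_one (by positivity) hRlo) hL0
        _ = 2 * (1 / L ^ (r - 1)) := by rw [hsplit]; field_simp
        _ ≤ 2 * L ^ (-(1 / 6 : ℝ)) := mul_le_mul_of_nonneg_left (inv_pow_le_rpow_neg_sixth hL1 (by omega)) zero_le_two
    calc R ^ 9 * (16 * (S6 * L) * P / (R ^ 4) ^ 3) = 16 * S6 * P * (L * (R ^ 9 / (R ^ 4) ^ 3)) := by ring
      _ ≤ 16 * S6 * P * (L * (1 / R)) := by gcongr
      _ ≤ 16 * S6 * P * (2 * L ^ (-(1 / 6 : ℝ))) := mul_le_mul_of_nonneg_left hLR (by positivity)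
      _ = 32 * S6 * P * L ^ (-(1 / 6 : ℝ)) := by ring
  have hg1 : 0 ≤ L ^ (-(1 / 6 : ℝ)) := Real.rpow_nonneg hL0 _
  have hg2 : 0 ≤ L ^ N * x ^ (-(1 / 20 : ℝ)) := by positivity
  rw [mul_add]
  calc _ ≤ 32 * S6 * C_F * P * (L ^ N * x ^ (-(1 / 20 : ℝ))) + 32 * S6 * P * L ^ (-(1 / 6 : ℝ)) := add_le_add h1 h2
    _ ≤ _ := by nlinarith [mul_nonneg (mul_nonneg hS60.le hCF) hg1, mul_nonneg hS60.le hg2,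
        mul_nonneg (mul_nonneg hS60.le hCF) hg2, mul_nonneg hS60.le hg1]

/-- The tail term: `48D²P³(R+1)^{−1/6} ≤ 48D²P³ L^{−1/6}` for `L ≤ L^r ≤ R + 1`. [folklore] -/
theorem major_term_tail (hL3 : 3 ≤ Real.log x) {r : ℕ} (hr : 1 ≤ r) (hRfl : Real.log x ^ r ≤ R + 1)
    (hP : 1 ≤ P) (hD : 1 ≤ D) :
    48 * D ^ 2 * P ^ 3 * (R + 1) ^ (-(1 / 6 : ℝ)) ≤ (48 * D ^ 2 * P ^ 3) * Real.log x ^ (-(1 / 6 : ℝ)) := by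
  have hL1 : 1 ≤ Real.log x := by linarith
  have hLR : Real.log x ≤ R + 1 := le_trans (by simpa using pow_le_pow_right₀ hL1 hr) hRfl
  exact mul_le_mul_of_nonneg_left (Real.rpow_le_rpow_of_nonpos (by linarith) hLR (by norm_num)) (by positivity)

end Major

end SmoothArcs

end Literature.NumberTheory.Sieve

end
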